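import Summits.Ventures.HSemireg.WedgeApolarSiegelWindowCharP
import Summits.Ventures.HSemireg.WedgeHankelCoSiegelMonoid
import Summits.Ventures.HSemireg.WedgeHankelSubstitutionSingularSpectrum

/-!
# Venture HSemireg — THE SIEGEL CLASSES ARE A SUB-REPRESENTATION OF THE CLASS SPACE: `coSiegel_n ⊓ SI_n` is stable under every substitution `Sb g` and every pair mixing
# `Pm M`; the extreme spikes move by `Sb g (E_0) = Σ_a α^{n−a}β^a E_a`, `Sb g (E_n) = Σ_a γ^{n−a}δ^a E_a`, i.e. `≡ α^n E_0 + β^n E_n`, `γ^n E_0 + δ^n E_n` modulo the inner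
# spikes; and for `n = p^e` IN CHARACTERISTIC `p` the inner spikes ARE the Siegel classes, so the substitutions act on `classes / Siegel classes` through the
# FROBENIUS-TWISTED matrix `(α^{p^e} β^{p^e}; γ^{p^e} δ^{p^e})` — a proper, non-zero invariant subspace of th-7's class space (`e ≥ 1`)

HONEST FRAMING. Part of the Lean index of the computation cell `pub-hsemireg` (seat p10 gen 20, Sunday typer «UNIFORM-IN-n»).
Finite-dimensional EXTERIOR ALGEBRA + linear algebra ONLY: no variety, no cohomology theory, no sheaf, no Ext group, no semiregularity map;
nothing here says that HC / HC_CM / HC_AV holds; no Literature fact is declared or used.  Custodian versions as in `WedgeHankelSiegelIdeal` (1/3), `WedgeHankelCoSiegel`, `WedgeHankelFrameChange`;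
the dictionary (the class space = `Sym^n` of the letters' plane; in characteristic `p`, `Sym^{p^e}` contains the span of the non-extreme monomials as a `GL₂`-submodule with quotient
the `e`-th Frobenius twist of the standard representation) is QUOTED, never asserted.

WHAT IS IN THE TREE.  I16 (`WedgeHankelCoSiegelMonoid`): `Sb_mem_coSiegel`, `Pm_mem_coSiegel`; H1b `map_Sb_siegelIdeal_le`, I3 `Pm_mem_siegelIdeal` (the Siegel IDEAL is stable);
I19/J2: `coSiegel_n ⊓ SI_n = span{E_j : C(n,j) = 0 in K}`, `w_spike_mem_siegelIdeal_iff_of_prime_pow` (`n = p^e`: exactly `0 < j < p^e`), `finrank … = p^e − 1`; J1 `Sb_w_spike_zero`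
(`Sb g (E_0) = w_n(α^{n−j}β^j)`); gen 11 `w_eq_sum_spikes`; E `Ψs_w`, H1 `Ψs_eq_Sb`, `Sb_Sb`.  THIS FILE (namespace `Summit.Ventures.HSemireg.Wedge.KernelDuality` continued;
imports J2, I16, J1):
* §239 **`Sb_mem_coSiegel_inf_siegelIdeal`** / **`Pm_mem_coSiegel_inf_siegelIdeal`** (every `g`, every `M`, every `n`, every field: the Siegel classes are a sub-representation of
  the monoid `M₂(K) × M_n(K)`), `map_Sb_coSiegel_inf_siegelIdeal_le`; `coSiegel_inf_siegelIdeal_ne_coSiegel` (it is always PROPER: `E_0` is not a Siegel form).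
* §240 THE EXTREME SPIKES: `w_spike_top_eq_Ψs_spike_zero` (`E_n = Ψs E_0`), **`Sb_w_spike_top`** (`Sb g (E_n) = w_n(γ^{n−j}δ^j)`), `Sb_w_spike_zero_eq_sum` / `Sb_w_spike_top_eq_sum`
  (spike expansions), and for `n ≥ 1` **`Sb_w_spike_zero_sub_eq_sum` / `Sb_w_spike_top_sub_eq_sum`**: `Sb g (E_0) − (α^n E_0 + β^n E_n) = Σ_{0<a<n} α^{n−a}β^a E_a` and
  `Sb g (E_n) − (γ^n E_0 + δ^n E_n) = Σ_{0<a<n} γ^{n−a}δ^a E_a` (every field).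
* §241 `n = p^e` IN CHARACTERISTIC `p` (`[CharP K p]`): **`Sb_w_spike_zero_sub_mem_prime_pow` / `Sb_w_spike_top_sub_mem_prime_pow`** — `Sb g (E_0) ≡ α^{p^e} E_0 + β^{p^e} E_{p^e}` and
  `Sb g (E_{p^e}) ≡ γ^{p^e} E_0 + δ^{p^e} E_{p^e}` MODULO THE SIEGEL CLASSES `coSiegel ⊓ SI` (the Frobenius-twisted `2 × 2` action on the quotient), and
  `coSiegel_inf_siegelIdeal_ne_bot_prime_pow` (`e ≥ 1`: the invariant subspace is non-zero) — th-7's class space is REDUCIBLE under the substitutions in characteristic `p ∣ n = p^e`.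
NOT typed here: irreducibility of the class space in characteristic `0` (or `p > n`); the quotient module as a `Module.End`-valued representation; anything Ext-side.  New names only.
-/

open Module

namespace Summit.Ventures.HSemireg.Wedge.KernelDuality

open Summit.Ventures.HSemireg.Wedge Summit.Ventures.HSemireg.Wedge.Kunneth Summit.Ventures.HSemireg.Wedge.Hankel
  Summit.Ventures.HSemireg.Wedge.BasisFree Summit.Ventures.HSemireg.Wedge.HankelSiegel Summit.Ventures.HSemireg.Wedge.HankelSiegelIdeal
  Summit.Ventures.HSemireg.Wedge.KunnethKernel Summit.Ventures.HSemireg.Wedge.HankelRankOne Summit.Ventures.HSemireg.Wedge.HankelFrameChange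
  Summit.Ventures.HSemireg.Wedge.HankelPairMixing

variable (K : Type*) [Field K] {n : ℕ}

/-! ## §239. The Siegel classes are stable under every substitution and every pair mixing -/

/-- **`θ ∈ coSiegel_n ⊓ SI_n ⇒ Sb g θ ∈ coSiegel_n ⊓ SI_n`** for EVERY substitution `g` (singular included): the Siegel classes are a sub-representation (I16 + H1b). -/
theorem Sb_mem_coSiegel_inf_siegelIdeal (α β γ δ : K) {θ : HT K (In n)} (hθ : θ ∈ coSiegel K n n ⊓ siegelIdeal K n n) :
    Sb K α β γ δ θ ∈ coSiegel K n n ⊓ siegelIdeal K n n :=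
  ⟨Sb_mem_coSiegel K α β γ δ hθ.1, map_Sb_siegelIdeal_le K α β γ δ n ⟨θ, hθ.2, rfl⟩⟩

/-- submodule form: `Sb g (coSiegel_n ⊓ SI_n) ≤ coSiegel_n ⊓ SI_n`. -/
theorem map_Sb_coSiegel_inf_siegelIdeal_le (α β γ δ : K) :
    (coSiegel K n n ⊓ siegelIdeal K n n).map (Sb K (n := n) α β γ δ).toLinearMap ≤ coSiegel K n n ⊓ siegelIdeal K n n := by
  rintro _ ⟨θ, hθ, rfl⟩
  exact Sb_mem_coSiegel_inf_siegelIdeal K α β γ δ hθ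

/-- **`θ ∈ coSiegel_n ⊓ SI_n ⇒ Pm M θ ∈ coSiegel_n ⊓ SI_n`** for EVERY pair mixing `M` (I16 + I3). -/
theorem Pm_mem_coSiegel_inf_siegelIdeal (M : Matrix (Fin n) (Fin n) K) {θ : HT K (In n)} (hθ : θ ∈ coSiegel K n n ⊓ siegelIdeal K n n) :
    Pm K M θ ∈ coSiegel K n n ⊓ siegelIdeal K n n :=
  ⟨Pm_mem_coSiegel K M hθ.1, Pm_mem_siegelIdeal K M hθ.2⟩

/-- the invariant subspace is always PROPER: `coSiegel_n ⊓ SI_n ≠ coSiegel_n` (`E_0` is a class but not a Siegel form, I19). -/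
theorem coSiegel_inf_siegelIdeal_ne_coSiegel : coSiegel K n n ⊓ siegelIdeal K n n ≠ coSiegel K n n := by
  intro h
  have h0 : w K n n (fun i => if i = 0 then (1 : K) else 0) ∈ coSiegel K n n ⊓ siegelIdeal K n n := by rw [h]; exact w_mem_coSiegel K _
  exact w_spike_zero_not_mem_siegelIdeal K h0.2

/-! ## §240. How the extreme spikes move -/

/-- `E_n = Ψs E_0`: the swap exchanges the pure class `E_0 = Π x_a` and the point class `E_n = Π y_a`. -/
theorem w_spike_top_eq_Ψs_spike_zero : w K n n (fun j => if j = n then (1 : K) else 0) = Ψs K (w K n n (fun j => if j = 0 then (1 : K) else 0)) := by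
  rw [Ψs_w K le_rfl]
  refine (w_eq_w_iff K _ _).2 fun j hj => ?_
  rw [rev_apply_of_le K hj]
  by_cases h : j = n
  · rw [if_pos h, if_pos (by omega)]
  · rw [if_neg h, if_neg (by omega)]

/-- `Ψs = Sb 0 1 1 0` on forms (H1 `Ψs_eq_Sb`). -/
private lemma Ψs_apply_eq_Sb (f : HT K (In n)) : Ψs K f = Sb K 0 1 1 0 f := by
  rw [← Ψs_eq_Sb]; rfl

/-- **`Sb g (E_n) = w_n((γ^{n−j} δ^j)_j)`**: the image of the point class (`E_n = Ψs E_0`, `Sb g ∘ Ψs = Sb(γ δ α β)`, J1 `Sb_w_spike_zero`). -/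
theorem Sb_w_spike_top (α β γ δ : K) : Sb K α β γ δ (w K n n (fun j => if j = n then (1 : K) else 0)) = w K n n (fun j => γ ^ (n - j) * δ ^ j) := by
  rw [w_spike_top_eq_Ψs_spike_zero, Ψs_apply_eq_Sb, Sb_Sb]
  simp only [zero_mul, one_mul, zero_add, add_zero]
  exact Sb_w_spike_zero K γ δ α β

/-- spike expansion of the image of `E_0`: `Sb g (E_0) = Σ_{a ≤ n} α^{n−a}β^a · E_a`. -/
theorem Sb_w_spike_zero_eq_sum (α β γ δ : K) :
    Sb K α β γ δ (w K n n (fun j => if j = 0 then (1 : K) else 0)) = ∑ a ∈ Finset.range (n + 1), (α ^ (n - a) * β ^ a) • w K n n (fun j => if j = a then (1 : K) else 0) := by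
  rw [Sb_w_spike_zero, w_eq_sum_spikes]

/-- spike expansion of the image of `E_n`: `Sb g (E_n) = Σ_{a ≤ n} γ^{n−a}δ^a · E_a`. -/
theorem Sb_w_spike_top_eq_sum (α β γ δ : K) :
    Sb K α β γ δ (w K n n (fun j => if j = n then (1 : K) else 0)) = ∑ a ∈ Finset.range (n + 1), (γ ^ (n - a) * δ ^ a) • w K n n (fun j => if j = a then (1 : K) else 0) := by
  rw [Sb_w_spike_top, w_eq_sum_spikes]

omit [Field K] in
/-- `[0, n] = {n} ∪ {0} ∪ (0, n)` for `n ≥ 1`. -/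
private lemma range_succ_eq_insert_insert_Ioo (hn : 1 ≤ n) : Finset.range (n + 1) = insert n (insert 0 (Finset.Ioo 0 n)) := by
  ext a
  simp only [Finset.mem_range, Finset.mem_insert, Finset.mem_Ioo]
  omega

/-- **`Sb g (E_0) − (α^n E_0 + β^n E_n) = Σ_{0<a<n} α^{n−a}β^a · E_a`** (`n ≥ 1`, every field): modulo the inner spikes the pure class moves by the first column of `g^{(n)}`. -/
theorem Sb_w_spike_zero_sub_eq_sum (hn : 1 ≤ n) (α β γ δ : K) :
    Sb K α β γ δ (w K n n (fun j => if j = 0 then (1 : K) else 0)) -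
        (α ^ n • w K n n (fun j => if j = 0 then (1 : K) else 0) + β ^ n • w K n n (fun j => if j = n then (1 : K) else 0)) =
      ∑ a ∈ Finset.Ioo 0 n, (α ^ (n - a) * β ^ a) • w K n n (fun j => if j = a then (1 : K) else 0) := by
  rw [Sb_w_spike_zero_eq_sum, range_succ_eq_insert_insert_Ioo hn, Finset.sum_insert (by simp only [Finset.mem_insert, Finset.mem_Ioo]; omega),
    Finset.sum_insert (by simp only [Finset.mem_Ioo]; omega), Nat.sub_self, pow_zero, one_mul, Nat.sub_zero, pow_zero, mul_one]
  abel

/-- **`Sb g (E_n) − (γ^n E_0 + δ^n E_n) = Σ_{0<a<n} γ^{n−a}δ^a · E_a`** (`n ≥ 1`): the point class moves by the second column of `g^{(n)}`. -/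
theorem Sb_w_spike_top_sub_eq_sum (hn : 1 ≤ n) (α β γ δ : K) :
    Sb K α β γ δ (w K n n (fun j => if j = n then (1 : K) else 0)) -
        (γ ^ n • w K n n (fun j => if j = 0 then (1 : K) else 0) + δ ^ n • w K n n (fun j => if j = n then (1 : K) else 0)) =
      ∑ a ∈ Finset.Ioo 0 n, (γ ^ (n - a) * δ ^ a) • w K n n (fun j => if j = a then (1 : K) else 0) := by
  rw [Sb_w_spike_top_eq_sum, range_succ_eq_insert_insert_Ioo hn, Finset.sum_insert (by simp only [Finset.mem_insert, Finset.mem_Ioo]; omega),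
    Finset.sum_insert (by simp only [Finset.mem_Ioo]; omega), Nat.sub_self, pow_zero, one_mul, Nat.sub_zero, pow_zero, mul_one]
  abel

/-! ## §241. `n = p^e` in characteristic `p`: the Frobenius-twisted action modulo the Siegel classes -/

/-- the inner spikes are Siegel classes for `n = p^e` in characteristic `p` (J2). -/
theorem sum_Ioo_smul_spike_mem_prime_pow (p : ℕ) [CharP K p] (hp : p.Prime) (e : ℕ) (c : ℕ → K) :
    ∑ a ∈ Finset.Ioo 0 (p ^ e), c a • w K (p ^ e) (p ^ e) (fun j => if j = a then (1 : K) else 0) ∈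
      coSiegel K (p ^ e) (p ^ e) ⊓ siegelIdeal K (p ^ e) (p ^ e) := by
  refine Submodule.sum_mem _ fun a ha => Submodule.smul_mem _ _ ⟨w_mem_coSiegel K _, ?_⟩
  rw [Finset.mem_Ioo] at ha
  exact (w_spike_mem_siegelIdeal_iff_of_prime_pow K p hp ha.2.le).mpr ⟨by omega, by omega⟩

/-- **`Sb g (E_0) ≡ α^{p^e} E_0 + β^{p^e} E_{p^e}` MODULO THE SIEGEL CLASSES, for `n = p^e` in characteristic `p`** (every `g`, every `e`): on the quotient of th-7's class space by its
invariant subspace of Siegel classes the substitutions act through the FROBENIUS-TWISTED matrix `(α^{p^e}, β^{p^e}; γ^{p^e}, δ^{p^e})`, first column. -/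
theorem Sb_w_spike_zero_sub_mem_prime_pow (p : ℕ) [CharP K p] (hp : p.Prime) (e : ℕ) (α β γ δ : K) :
    Sb K α β γ δ (w K (p ^ e) (p ^ e) (fun j => if j = 0 then (1 : K) else 0)) -
        (α ^ p ^ e • w K (p ^ e) (p ^ e) (fun j => if j = 0 then (1 : K) else 0) + β ^ p ^ e • w K (p ^ e) (p ^ e) (fun j => if j = p ^ e then (1 : K) else 0)) ∈
      coSiegel K (p ^ e) (p ^ e) ⊓ siegelIdeal K (p ^ e) (p ^ e) := by
  rw [Sb_w_spike_zero_sub_eq_sum K (Nat.one_le_pow e p hp.pos)]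
  exact sum_Ioo_smul_spike_mem_prime_pow K p hp e fun a => α ^ (p ^ e - a) * β ^ a

/-- **`Sb g (E_{p^e}) ≡ γ^{p^e} E_0 + δ^{p^e} E_{p^e}` MODULO THE SIEGEL CLASSES** (second column of the Frobenius-twisted matrix). -/
theorem Sb_w_spike_top_sub_mem_prime_pow (p : ℕ) [CharP K p] (hp : p.Prime) (e : ℕ) (α β γ δ : K) :
    Sb K α β γ δ (w K (p ^ e) (p ^ e) (fun j => if j = p ^ e then (1 : K) else 0)) -
        (γ ^ p ^ e • w K (p ^ e) (p ^ e) (fun j => if j = 0 then (1 : K) else 0) + δ ^ p ^ e • w K (p ^ e) (p ^ e) (fun j => if j = p ^ e then (1 : K) else 0)) ∈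
      coSiegel K (p ^ e) (p ^ e) ⊓ siegelIdeal K (p ^ e) (p ^ e) := by
  rw [Sb_w_spike_top_sub_eq_sum K (Nat.one_le_pow e p hp.pos)]
  exact sum_Ioo_smul_spike_mem_prime_pow K p hp e fun a => γ ^ (p ^ e - a) * δ ^ a

/-- **for `e ≥ 1` the invariant subspace of Siegel classes is NON-ZERO** (`E_1` lies in it; with §239 and `coSiegel_inf_siegelIdeal_ne_coSiegel`: th-7's class space of degree `p^e` is
REDUCIBLE under the substitutions in characteristic `p`; its dimension is `p^e − 1`, J2). -/
theorem coSiegel_inf_siegelIdeal_ne_bot_prime_pow (p : ℕ) [CharP K p] (hp : p.Prime) {e : ℕ} (he : 1 ≤ e) :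
    coSiegel K (p ^ e) (p ^ e) ⊓ siegelIdeal K (p ^ e) (p ^ e) ≠ ⊥ := by
  have h1 : 1 < p ^ e := Nat.one_lt_pow (by omega) hp.one_lt
  intro h
  have hmem : w K (p ^ e) (p ^ e) (fun j => if j = 1 then (1 : K) else 0) ∈ coSiegel K (p ^ e) (p ^ e) ⊓ siegelIdeal K (p ^ e) (p ^ e) :=
    ⟨w_mem_coSiegel K _, (w_spike_mem_siegelIdeal_iff_of_prime_pow K p hp h1.le).mpr ⟨one_ne_zero, h1.ne⟩⟩
  rw [h, Submodule.mem_bot] at hmem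
  exact w_spike_ne_zero K h1.le hmem

end Summit.Ventures.HSemireg.Wedge.KernelDuality
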